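import Literature.MathematicalPhysics.QuantumFieldTheory.Balaban1983to89.B8Eq131Cubes

/-!
# `Balaban1983to89.B8Prop6OfThm4` — B8 p. 99: "the assumptions of Theorem 4 are satisfied for the pair of
# configurations 1, U₀″" — Proposition 6 ((1.134)–(1.138)) from (1.132)/(1.133) and Theorem 4 (p. 88)

T. Bałaban, *Spaces of regular gauge field configurations on a lattice and gauge fixing conditions*, Commun.
Math. Phys. **99** (1985) 75–102 `[Balaban1985RegularSpaces]` ("B8"), Sect. F pp. 98–99 and Theorem 4 p. 88.
STATUS: a published, refereed paper; this file TYPES the printed hypotheses of Theorem 4 for the background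
configuration `U₀ = 1` and the admissible family `{□_j}` of (1.131) ((1.33) first clause, (1.34), (1.66) via
(1.20)), PROVES that the configuration `U₀″` of p. 99 — whose properties (1.132), (1.133) are kernel-certified in
the companions `B8Ineq132`, `B8Ineq133`, `B8Eq131Cubes` — satisfies them with the printed constants, DERIVES the
existence statement of Proposition 6 and its clause (1.135) from Theorem 4 taken as an explicitly displayed
HYPOTHESIS (an interface in which the untyped Landau-gauge notions of (1.29), (1.36)–(1.39), (1.62) are abstract
predicates), and PROVES the bond inequality of (1.137) for this `U₀′` outright.  Theorem 4 itself (Sects. C–E) is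
the paper's main result and is NOT certified here; no programme-internal claim is used; every `theorem` below is
`sorry`-free over Mathlib and the tree.

## THE PRINTED TEXT (verbatim; renders `1985-cmp99-regular-spaces-gauge-fixing-pNNN-x2.png`, PDF page =
## journal page − 74)

p. 79 [PDF 5]: "where `Ũ′ⁿ` is defined by the equalities `Ũ′ⁿ = (\overline{U′U₀})ⁿ(Ū₀ⁿ)⁻¹`. (1.20)"

p. 81 [PDF 7]: "`(\overline{R₀uʲ})(y) = 1` for `y ∈ Λ_j`, `j = 0, 1, …, k`, (1.29)".

p. 82 [PDF 8]: "`U₀ ∈ 𝔄_k({Ω_j}, α₀)`, `U₀` satisfies the regularity condition (3.35) in [4]. (1.33)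
`U′U₀ ∈ 𝔄_k({Ω_j}, α₀) ∩ Ax_k(𝔅_k, U₀)`, (1.34) `|(\overline{U′U₀})ʲ − Ū₀ʲ| < α₁` on `Λ_j`, `j = 0, 1, …, k`.
(1.35)".

p. 87 [PDF 13]: "`|(\overline{U′U₀})ʲ − Ū₀ʲ| = |Ũ′ʲ − 1| < α₁` on `Ω_j^{(j)}`, `j = 0, 1, …, k`. (1.66)".

p. 88 [PDF 14]: "**Theorem 4.** There exists a constant `c₁` such that for arbitrary `U₀`, `U′U₀` satisfying
(1.33), (1.34), (1.66) with `α₀ + α₁ ≤ c₁` there exists exactly one gauge transformation `u` satisfying (1.29) and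
such that the conditions (1.37), (1.38), (1.62) hold for the configuration `U₁ = U′^{u⁻¹}`.
Of course this theorem implies Theorem 2. Proposition 3 implies that it is enough to prove (1.37), (1.38) and
`|A| < B′₁(α₀ + α₁)(Lʲη)⁻¹` on `Ω_j`, `B′₁ = C′₁5B₀`, (1.67)".

p. 99 [PDF 25]: "and let us define a configuration `U₀″` as equal to `U₀′` on `□̃`, and equal to `1` outside
`□̃`. It satisfies the conditions `U₀″ ∈ 𝔄_k({□_j}, L³α₀) ∩ Ax_k(ℭ_k, 1)`, (1.132)
`|\overline{U₀″}ʲ − 1| < 6dL²Mα₀` on `□_j^{(j)}`, `j = 0, 1, …, k`, (1.133) by the construction of `U₀″`, and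
the inequality (1.130). If `7dL²Mα₀ ≤ c₁`, then the assumptions of Theorem 4 are satisfied for the pair of
configurations `1, U₀″`, thus there exists a gauge transformation `u` such that `U₁ = U₀″^{u⁻¹}` satisfies the
conditions (1.36)–(1.39). Especially we have for `M = R₁M₁`,
`U₁ = e^{iηA}`, `|A|, |∇^ηA| < 7dL²B₁R₁M₁α₀` on `□`. (1.134)
The configuration `U₁` in a neighborhood of `□` is obtained from `U₀` by a gauge transformation, hence for `α₀`
sufficiently small we have proved the regularity condition (3.35).
This implies that we can drop out this condition from the assumption (1.33).
We formulate the more general result in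
**Proposition 6.** Let `U₀, U₀′, □, □̃` be as described above, and let `7dL²Mα₀ ≤ c₁`. There exists a gauge
transformation `u` defined on `□̃` and such, that
`U₀^{u⁻¹} = U₁ = e^{iηA}` on `□̃`, (1.135)
`Lʲη|A|, (Lʲη)²|∇^ηA|, (Lʲη)³|∂^{η*}∂^ηA|, (Lʲη)³|Δ^ηA| < 7dL²B₁Mα₀` on `□_j`, (1.136)
`Q_k(ηA) = (1/i) log \overline{U₀′}ᵏ` on `□^{(k)}`, `|(1/i) log \overline{U₀′}ᵏ(x, x′)| < |x − y|4α₀ ≤ 2dMα₀`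
for `⟨x, x′⟩ ⊂ □^{(k)}`, `y` is a center of `□`, (1.137)
`R∂^{η*}A = 0`, the operator `R` is determined by `{□_j}`. (1.138)
The functions and derivatives above are defined without any external gauge field configuration (or the
configuration is equal to 1)."

## WHAT IS CERTIFIED (kernel; axioms `propext`, `Classical.choice`, `Quot.sound` only)

The paper-internal bookkeeping of the sentence "If `7dL²Mα₀ ≤ c₁`, then the assumptions of Theorem 4 are
satisfied for the pair of configurations `1, U₀″`" and what it yields:
* `one_inAk` — (1.33), first clause, for the background `U₀ = 1`: `1 ∈ 𝔄_k({Ω_j}, α)` for every family `{Ω_j}`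
  and every `α > 0` (all plaquette variables of `1` are `1` and all covariant divergences (1.2) of `∂1` vanish:
  `plaqF_one`, `covDiv_one`).
* `tavg` / `tavg_one` — (1.20) bondwise, and `Ũ′ⁿ = Ū′ⁿ` for `U₀ = 1` (`\overline{1}ⁿ = 1`,
  `B8Ineq132.avgIter_one`); hence (1.66) for the pair `1, U′` on the family `{□_j}` (`Cond166`) reads
  `|Ū′ʲ − 1| < α₁` on `□_j^{(j)}` (`cond166_one_iff`) — for `U′ = U₀″` this IS (1.133); and (1.34) for the pair
  is (1.132) (`U′U₀ = U₀″`).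
* `Thm4AtOne` — THE INTERFACE (HYPOTHESIS SHAPE): Theorem 4 for the background `1` and the family `{□_j}`,
  `ℭ_k` of (1.131), with the untyped notions abstract (see HONEST SCOPE).  It is a `def … : Prop` used only as a
  hypothesis `(hThm4 : Thm4AtOne …)`; no instance is constructed.
* `prop6_of_thm4` — GIVEN `Thm4AtOne`, every `G`-valued `U₀ ∈ 𝔄_k({Ω_j}, α₀)` with `□̃ ⊂ Ω_{k−1}` (p. 98) and
  the smallness of Sect. F yields: the configuration `U₀″ = B8Ineq133.cutFixed …` satisfies the hypotheses of
  Theorem 4 with `(α₀, α₁) ↦ (L³α₀, 6dL²Mα₀)` ((1.132), (1.133), `one_inAk`) as soon as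
  `L³α₀ + 6dL²Mα₀ ≤ c₁`; so the gauge transformation `u` of Theorem 4 exists, uniquely, is `G`-valued, satisfies
  (1.29) and gives `U₁ = U₀″^{u⁻¹}` the properties (1.36)–(1.39) [abstract]; and (1.135) holds in the form
  "`U₀^{w⁻¹} = U₀″^{u⁻¹} (= U₁)` on the bonds of `□̃`" with the `G`-valued `w := v⁻¹u`, `v` = the gauge
  transformation `U₀ ↦ U₀′ = U₀^{v}` of p. 98 (`B8Eq115GaugeFixing.localGauge`) — Prop. 6's "`u` defined on `□̃`"
  is this `w` (`agree135`: pure gauge algebra, `U₀″ = U₀′` on `□̃`).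
* `smallness_134` / `const_136` — print's threshold and constant: `L³α₀ + 6dL²Mα₀ ≤ 7dL²Mα₀ ⟺ L ≤ dM`
  (`B8.prop6_smallness_iff`), so "`7dL²Mα₀ ≤ c₁`" gives Theorem 4's "`α₀ + α₁ ≤ c₁`" exactly when `L ≤ dM`
  (`prop6_of_thm4_printed`), and `B₁(L³α₀ + 6dL²Mα₀) ≤ 7dL²B₁Mα₀` (the constant of (1.134), `M = R₁M₁`, and
  of (1.136)); "on `□`" ⊂ "on `□_k`" is `B8Eq131Cubes.box_subset_cube_top`.
* `ineq137_cube` — (1.137), the inequalities, for THIS `U₀′` and independently of Theorem 4: for every bond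
  `⟨x, x + e_μ⟩ ⊂ □^{(k)} = [a, a + M − 1]^d`:
  `‖(1/i) log Ū₀′ᵏ(x, x + e_μ)‖ ≤ |x − y|₁·4α₀ ≤ 2dMα₀`, `y = B8Eq131Cubes.ctr a M` (a centre of `□^{(k)}`
  and of the concentric `□̃^{(k)}` of p. 98), and `\overline{U₀″}ᵏ = Ū₀′ᵏ` on these bonds.  Chain: `□ ⊂ Ω_k` and
  (1.7) at `j = k` give `sup_{p ⊂ □}|U₀(∂p) − 1| < α₀L^{−2k}` (`pdevOn_lt_of_inAk_top`); gauge invariance and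
  locality move it to the global carrier `(π*U₀|□̃)^{v}`; Proposition 2 of [3] localised with `α₀/L²` for `α₀`
  (`B8Ineq130.ineq128_local`) gives `|Ū₀′ᵏ(∂p′) − 1| < 2α₀` on `□^{(k)}`; the global axial gauge of `Ū₀′ᵏ` at `y`
  (`B8Eq115GaugeFixing.gaugeFix_global`) and (1.129) (`B8Ineq129.ineq137_log_printed`, radius `⌊M/2⌋`,
  `2⌊M/2⌋ ≤ M`, `dMα₀ ≤ 1/2`) give the bound; locality of (43) (`B8Ineq133.avgIter_eq_of_agree`) identifies the
  three `k`-fold averages on `□^{(k)} ⊂ □̃^{(k)}`.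

## DICTIONARY / HONEST SCOPE

* Lattice model as in the companions: every level `T^{(j)}` is `ℤ^d` (`Site d = Fin d → ℤ`), the fine lattice
  `T_η` is depth `k`; `U₀ : Site d → Fin d → 𝔸ˣ` with values in an `AvgClosed` subgroup `G ≤ U1 𝔸` of the
  unit-norm units of a complete normed `ℂ`-algebra `𝔸`; `V^{u} = gaugeAct u V`, so print's `U′^{u⁻¹}` is
  `gaugeAct u⁻¹ U′` (pointwise inverse); `□, □̃, □_j, Λ′_j/ℭ_k` = `B8Eq131Cubes.box/tcube/cube/LamP` with lower
  corner `a`, side `M`, `ρ = R₁M₁`; `U₀′ = gaugeAct (localGauge …) U₀`, `U₀″ = cutFixed …`; `𝔄_k` = `B8Ineq132.InAk`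
  (touching convention of p. 77), `Ax_k(ℭ, 1)` = `B8Ineq132.InAxOne`; `log` = `MatrixLog.mlog`.
* NOT TYPED (abstract in `Thm4AtOne`): the block averaging `R₀` of gauge transformations in (1.29) — `Restr u`
  stands for "`u` satisfies (1.29) w.r.t. `{Λ′_j}`"; the fields `A = (iη)⁻¹ log U₁`, `B` of (1.31), the operators
  `Q_j`, `R`, `∇^η`, `∂^η`, `∂^{η*}`, `Δ^η` and the norms of (1.36)–(1.39)/(1.62) — `Concl α₀ α₁ U′ u` stands for
  "(1.37), (1.38), (1.62), hence (1.36)–(1.39) by Proposition 3, hold for `U₁ = U′^{u⁻¹}` with the constants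
  `α₀, α₁`"; and "the regularity condition (3.35) in [4]" (second clause of (1.33)) — for `U₀ = 1` print itself
  drops it (p. 99), and the interface does not carry it.  Consequently (1.134), (1.136), (1.138) and the identity
  `Q_k(ηA) = (1/i) log Ū₀′ᵏ` of (1.137) live inside `Concl` and are NOT certified; certified of them are the
  arithmetic of the constants and the inclusion `□ ⊂ □_k`.
* (1.66)/(1.133) are read, as in `B8Ineq133`/`B8Eq131Cubes`, for the bonds `⟨x, x + e_ν⟩` with both endpoints in
  `□_j^{(j)} = [sqLo j, sqHi j]`.
* (1.137): the tree proves `≤ |x − y|₁·4α₀` where print writes `<` (on the bonds of the axial tree through `y`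
  both sides vanish, so the printed strict inequality cannot hold there; cf. `B8Ineq129`); `|x − y|` is read as
  the `ℓ¹` distance (`B7Prop1Explicit.l1`), for which `|x − y|₁·4α₀ ≤ 2dMα₀` on `□^{(k)}`.
* Print's step "`7dL²Mα₀ ≤ c₁` ⟹ `α₀′ + α₁′ = L³α₀ + 6dL²Mα₀ ≤ c₁`" holds iff `L ≤ dM` (`smallness_134`;
  implicit in print, automatic in the paper's regime `M ≥ R₁M₁ ≫ L`); the main theorem carries
  `L³α₀ + 6dL²Mα₀ ≤ c₁` and `prop6_of_thm4_printed` the printed form plus `L ≤ dM`.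
-/

noncomputable section

open scoped BigOperators
open Finset

namespace Literature.MathematicalPhysics.QuantumFieldTheory.Balaban1983to89.B8Prop6OfThm4

open B7Prop1Explicit B7Prop2Explicit B7Prop1Local B7AvgGaugeCovariance B8Ineq130 B8Eq115GaugeFixing B8Ineq133
  B8Ineq132 B8Eq131Cubes B8Ineq129 MatrixLog
open B7Eq78Linearization (conjR conjR_apply)
export B7Prop1Explicit (Site)

variable {d : ℕ}

/-! ## §1. Gauge algebra of (1.135): `U₀^{(v⁻¹u)⁻¹} = (U₀^{v})^{u⁻¹} = U₀″^{u⁻¹}` on `□̃` -/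

section Algebra

variable {G : Type*} [Group G]

/-- **(1.135), the algebra**: for the gauge transformation `v` (`U₀′ = U₀^{v}`), the cut-off `U₀″` of `U₀′` to the
box `[lo, hi]` and any `u`: `U₀^{w⁻¹} = U₀″^{u⁻¹}` on the bonds of the box, `w = v⁻¹u` ((8) of [3]:
`(V^{v})^{u⁻¹} = V^{u⁻¹v}`, and `U₀″ = U₀′` on `□̃`). [cite: Balaban1985RegularSpaces, Prop. 6 (1.135) p.99] -/
theorem agree135 (lo hi : Site d) (U₀ : Site d → Fin d → G) (v u : Site d → G) :
    AgreeOn lo hi (gaugeAct (v⁻¹ * u)⁻¹ U₀) (gaugeAct u⁻¹ (cutCfg lo hi (gaugeAct v U₀))) := by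
  rw [mul_inv_rev, inv_inv, gaugeAct_mul]
  exact (gaugeAct_agree (cutCfg_agree lo hi (gaugeAct v U₀)) u⁻¹).symm

end Algebra

/-! ## §2. Arithmetic of the constants: "`7dL²Mα₀ ≤ c₁`", (1.134), (1.136) -/

/-- **"If `7dL²Mα₀ ≤ c₁`, then the assumptions of Theorem 4 are satisfied"** — the smallness: Theorem 4 asks
`α₀′ + α₁′ ≤ c₁` with `α₀′ = L³α₀` ((1.132)) and `α₁′ = 6dL²Mα₀` ((1.133)); since
`L³α₀ + 6dL²Mα₀ ≤ 7dL²Mα₀ ⟺ L ≤ dM` (`B8.prop6_smallness_iff`), the printed hypothesis suffices when `L ≤ dM`.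
[cite: Balaban1985RegularSpaces, p.99 (sentence after (1.133)), Prop. 6 p.99] -/
theorem smallness_134 {d L M α₀ c₁ : ℝ} (hL : 0 < L) (hα : 0 < α₀) (hLdM : L ≤ d * M)
    (h : 7 * d * L ^ 2 * M * α₀ ≤ c₁) : L ^ 3 * α₀ + 6 * d * L ^ 2 * M * α₀ ≤ c₁ :=
  ((B8.prop6_smallness_iff hL hα).2 hLdM).trans h

/-- **The constant of (1.134)/(1.136)**: (1.36) for the pair gives `B₁(α₀′ + α₁′) = B₁(L³α₀ + 6dL²Mα₀)`, and
`B₁(L³α₀ + 6dL²Mα₀) ≤ 7dL²B₁Mα₀` (`L ≤ dM`, `B₁ ≥ 0`); (1.134) is the case `M = R₁M₁`.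
[cite: Balaban1985RegularSpaces, (1.134), (1.136) p.99, (1.36) p.82] -/
theorem const_136 {d L M α₀ B₁ : ℝ} (hL : 0 < L) (hα : 0 < α₀) (hB : 0 ≤ B₁) (hLdM : L ≤ d * M) :
    B₁ * (L ^ 3 * α₀ + 6 * d * L ^ 2 * M * α₀) ≤ 7 * d * L ^ 2 * B₁ * M * α₀ :=
  calc B₁ * (L ^ 3 * α₀ + 6 * d * L ^ 2 * M * α₀) ≤ B₁ * (7 * d * L ^ 2 * M * α₀) :=
        mul_le_mul_of_nonneg_left ((B8.prop6_smallness_iff hL hα).2 hLdM) hB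
    _ = 7 * d * L ^ 2 * B₁ * M * α₀ := by ring

section Analytic

variable {𝔸 : Type*} [NormedRing 𝔸] [NormOneClass 𝔸] [NormedAlgebra ℂ 𝔸] [CompleteSpace 𝔸]

/-! ## §3. (1.33), first clause, for the background `U₀ = 1` -/

omit [NormOneClass 𝔸] [NormedAlgebra ℂ 𝔸] [CompleteSpace 𝔸] in
/-- `1(∂p) = 1`: every plaquette variable (1.2) of the configuration `1` is `1`. [folklore] -/
theorem plaqF_one (μ ν : Fin d) (x : Site d) : plaqF (1 : Site d → Fin d → 𝔸ˣ) μ ν x = 1 := by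
  rw [plaqF, hol_one, Units.val_one]

omit [NormOneClass 𝔸] [CompleteSpace 𝔸] in
/-- `(D^{η*}_{1,ν} 1)(x) = η⁻¹(R(1)1 − 1) = 0` ((1.1) for the configuration `1` and the constant field `1`).
[cite: Balaban1985RegularSpaces, (1.1) p.76] -/
theorem covDeriv_one_const (η : ℝ) (ν : Fin d) (x : Site d) :
    covDeriv η (1 : Site d → Fin d → 𝔸ˣ) ν (fun _ => (1 : 𝔸)) x = 0 := by
  simp [covDeriv, conjR_apply]

omit [NormOneClass 𝔸] [CompleteSpace 𝔸] in
/-- `(D^{η*}_1 ∂1)(b) = 0` for every bond `b` ((1.2) for the configuration `1`). [cite: Balaban1985RegularSpaces, (1.2) p.76] -/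
theorem covDiv_one (η : ℝ) (μ : Fin d) (x : Site d) : covDiv η (1 : Site d → Fin d → 𝔸ˣ) μ x = 0 := by
  have h : ∀ κ κ' : Fin d, plaqF (1 : Site d → Fin d → 𝔸ˣ) κ κ' = fun _ => (1 : 𝔸) :=
    fun κ κ' => funext fun z => plaqF_one κ κ' z
  simp only [covDiv, h, covDeriv_one_const, Finset.sum_const_zero, sub_self]

omit [NormOneClass 𝔸] [CompleteSpace 𝔸] in
/-- **(1.33), first clause, for `U₀ = 1`**: `1 ∈ 𝔄_k({Ω_j}, α)` for every family `{Ω_j}`, every `η > 0` and every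
`α > 0` — both (1.7) and (1.9) hold with left side `0` ("the pair of configurations `1, U₀″`", p. 99).
[cite: Balaban1985RegularSpaces, (1.33) p.82, (1.7)/(1.9) p.77, p.99] -/
theorem one_inAk {L : ℕ} (hL : 1 ≤ L) (k : ℕ) {η α : ℝ} (hη : 0 < η) (hα : 0 < α) (Ω : ℕ → Set (Site d)) :
    InAk L k η α Ω (1 : Site d → Fin d → 𝔸ˣ) := by
  have hL0 : 0 < L := hL
  intro j _
  refine ⟨fun x μ ν _ _ => ?_, fun x μ _ => ?_⟩
  · rw [plaqF_one, sub_self, norm_zero]; positivity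
  · rw [covDiv_one, norm_zero]; positivity

/-! ## §4. (1.20) and (1.66) for the pair `1, U′` on the family `{□_j}` -/

omit [NormOneClass 𝔸] in
/-- **(1.20)**, bondwise: `Ũ′ⁿ = (\overline{U′U₀})ⁿ(Ū₀ⁿ)⁻¹` (the averages (43) of [3], `B7Prop2Explicit.avgIter`).
[cite: Balaban1985RegularSpaces, (1.20) p.79] -/
def tavg (L : ℕ) (U₀ U' : Site d → Fin d → 𝔸ˣ) (n : ℕ) : Site d → Fin d → 𝔸ˣ :=
  fun x κ => avgIter L (U' * U₀) n x κ * (avgIter L U₀ n x κ)⁻¹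

omit [NormOneClass 𝔸] in
/-- For the background `U₀ = 1`: `Ũ′ⁿ = Ū′ⁿ` (`U′·1 = U′`, `\overline{1}ⁿ = 1`).
[cite: Balaban1985RegularSpaces, (1.20) p.79, p.99 ("the pair of configurations 1, U₀″")] -/
theorem tavg_one (L : ℕ) (U' : Site d → Fin d → 𝔸ˣ) (n : ℕ) :
    tavg L (1 : Site d → Fin d → 𝔸ˣ) U' n = avgIter L U' n := by
  funext x κ
  simp only [tavg, mul_one, avgIter_one, Pi.one_apply, inv_one]

omit [NormOneClass 𝔸] in
/-- **(1.66) for the admissible family `{□_j}`** (the `Ω_j` of Theorem 4 applied on p. 99): `|Ũ′ʲ − 1| < α₁` on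
(the bonds `⟨x, x + e_ν⟩` of) `□_j^{(j)} = [sqLo j, sqHi j]`, `j = 0, 1, …, k`.
[cite: Balaban1985RegularSpaces, (1.66) p.87, p.99] -/
def Cond166 (L k : ℕ) (a : Site d) (M ρ : ℕ) (U₀ U' : Site d → Fin d → 𝔸ˣ) (α₁ : ℝ) : Prop :=
  ∀ j, j ≤ k → ∀ (x : Site d) (ν : Fin d), sqLo L a ρ k j ≤ x → x + e ν ≤ sqHi L a M ρ k j →
    ‖((tavg L U₀ U' j x ν : 𝔸ˣ) : 𝔸) - 1‖ < α₁

omit [NormOneClass 𝔸] in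
/-- **(1.66) for the pair `1, U′` IS the shape of (1.133)**: `|Ū′ʲ − 1| < α₁` on `□_j^{(j)}`, `j = 0, …, k`.
[cite: Balaban1985RegularSpaces, (1.66) p.87, (1.133) p.99] -/
theorem cond166_one_iff (L k : ℕ) (a : Site d) (M ρ : ℕ) (U' : Site d → Fin d → 𝔸ˣ) (α₁ : ℝ) :
    Cond166 L k a M ρ (1 : Site d → Fin d → 𝔸ˣ) U' α₁ ↔
      ∀ j, j ≤ k → ∀ (x : Site d) (ν : Fin d), sqLo L a ρ k j ≤ x → x + e ν ≤ sqHi L a M ρ k j →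
        ‖((avgIter L U' j x ν : 𝔸ˣ) : 𝔸) - 1‖ < α₁ := by
  simp only [Cond166, tavg_one]

/-! ## §5. THE INTERFACE: Theorem 4 (p. 88) for the background `1` and the family `{□_j}` of (1.131) -/

omit [NormOneClass 𝔸] in
/-- **INTERFACE (HYPOTHESIS SHAPE) — Theorem 4, p. 88, specialised to `U₀ = 1`, `Ω_j = □_j` (`B8Eq131Cubes.cube`),
`𝔅_k = ℭ_k = ⋃ Λ′_j` (`B8Eq131Cubes.LamP`)**: "for arbitrary `U₀`, `U′U₀` satisfying (1.33), (1.34), (1.66) with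
`α₀ + α₁ ≤ c₁` there exists exactly one gauge transformation `u` satisfying (1.29) and such that the conditions
(1.37), (1.38), (1.62) hold for the configuration `U₁ = U′^{u⁻¹}`".  Here, for the pair `1, U′`: (1.33) =
`1 ∈ 𝔄_k({□_j}, α₀)` (its clause "(3.35) in [4]" is not typed — print drops it for this background, p. 99);
(1.34) = `U′ ∈ 𝔄_k({□_j}, α₀) ∩ Ax_k(ℭ_k, 1)` (`U′U₀ = U′`); (1.66) = `Cond166 … 1 U′ α₁`; `Restr u` abstracts
"`u` satisfies (1.29)", `Concl α₀ α₁ U′ u` abstracts "(1.37), (1.38), (1.62) [⟹ (1.36)–(1.39), Proposition 3] hold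
for `U₁ = U′^{u⁻¹} = gaugeAct u⁻¹ U′`"; `u` ranges over `G`-valued gauge transformations.  A HYPOTHESIS of
`prop6_of_thm4`, never instantiated in the tree. [cite: Balaban1985RegularSpaces, Thm. 4 p.88, (1.33)-(1.34) p.82, (1.66) p.87, (1.29) p.81] -/
def Thm4AtOne (L k : ℕ) (η c₁ : ℝ) (G : Subgroup 𝔸ˣ) (a : Site d) (M ρ : ℕ)
    (Restr : (Site d → 𝔸ˣ) → Prop) (Concl : ℝ → ℝ → (Site d → Fin d → 𝔸ˣ) → (Site d → 𝔸ˣ) → Prop) : Prop :=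
  ∀ ⦃α₀ α₁ : ℝ⦄, 0 < α₀ → 0 < α₁ → α₀ + α₁ ≤ c₁ →
    ∀ U' : Site d → Fin d → 𝔸ˣ, (∀ x κ, U' x κ ∈ G) →
      InAk L k η α₀ (cube L a M ρ k) (1 : Site d → Fin d → 𝔸ˣ) →
      InAk L k η α₀ (cube L a M ρ k) U' → InAxOne L k (LamP L a M ρ k) U' →
      Cond166 L k a M ρ (1 : Site d → Fin d → 𝔸ˣ) U' α₁ →
      ∃ u : Site d → 𝔸ˣ, ((∀ x, u x ∈ G) ∧ Restr u ∧ Concl α₀ α₁ U' u) ∧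
        ∀ u' : Site d → 𝔸ˣ, (∀ x, u' x ∈ G) → Restr u' → Concl α₀ α₁ U' u' → u' = u

/-! ## §6. Proposition 6 from Theorem 4: existence of `u`, (1.135) -/

/-- The gauge transformation `v` of p. 98 (`U₀′ = U₀^{v}`, `B8Eq115GaugeFixing.localGauge`) is `G`-valued, from
(1.7) on the plaquettes of `□̃` alone (`B8Eq115GaugeFixing.gaugeFix_global` on the clamped extension).
[cite: Balaban1985RegularSpaces, p.98 ("We apply a gauge transformation to U₀ …")] -/
theorem localGauge_mem (L : ℕ) (hL : 2 ≤ L) {G : Subgroup 𝔸ˣ} (hG : AvgClosed d L G) (k : ℕ)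
    (U₀ : Site d → Fin d → 𝔸ˣ) (hU : ∀ x κ, U₀ x κ ∈ G) {α₀ : ℝ} (hα : 0 < α₀)
    (hα3 : C0 d * (α₀ * (L : ℝ) ^ 2) ≤ 1 / 3) (hα2 : 2 * (α₀ * (L : ℝ) ^ 2) ≤ c2' d L)
    {lo hi : Site d} (hlohi : lo ≤ hi)
    (h17 : pdevOn (tlo L lo k) (thi L hi k) U₀ < α₀ * (L : ℝ) ^ 2 * (((L : ℝ) ^ k)⁻¹) ^ 2) (y x : Site d) :
    localGauge L lo hi U₀ k y x ∈ G := by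
  have hL1 : 1 ≤ L := le_trans (by norm_num) hL
  have hUU : ∀ x κ, U₀ x κ ∈ U1 𝔸 := fun x κ => hG.le_U1 (hU x κ)
  exact (gaugeFix_global L hL hG k _ (clampCfg_mem hU) hα hα3 hα2
    ((pdev_clampCfg_le (tlo_le_thi hL1 hlohi k) hUU).trans_lt h17) y).1 x

/-- **PROPOSITION 6 FROM THEOREM 4 (p. 99: "the assumptions of Theorem 4 are satisfied for the pair of
configurations `1, U₀″`, thus there exists a gauge transformation `u` such that `U₁ = U₀″^{u⁻¹}` satisfies the
conditions (1.36)–(1.39)").**  HYPOTHESES: the setting of Sect. F as in `B8Eq131Cubes.ineq132_cubes` (`G`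
`AvgClosed`, `L ≥ 2`, `d ≥ 1`, `U₀` `G`-valued in `𝔄_k({Ω_j}, α₀)`, `□̃ ⊂ Ω_{k−1}`, `1 ≤ R₁M₁ = ρ ≤ M`, `11d < M`,
the smallness of (1.130)), Theorem 4 in the shape `Thm4AtOne`, and `α₀′ + α₁′ = L³α₀ + 6dL²Mα₀ ≤ c₁`.
CONCLUSION: there is a `G`-valued `u` with (1.29) [`Restr`] such that `U₁ = U₀″^{u⁻¹}` has (1.36)–(1.39) with the
constants `(L³α₀, 6dL²Mα₀)` [`Concl`]; it is unique among such; `w := v⁻¹u` is `G`-valued; and (1.135):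
`U₀^{w⁻¹} = U₀″^{u⁻¹} = U₁` on the bonds of `□̃` (fine lattice, `[tlo k, thi k]` over `[tLo, tHi]`).
[cite: Balaban1985RegularSpaces, Prop. 6 (1.135) p.99, p.99 (paragraph after (1.133)), Thm. 4 p.88] -/
theorem prop6_of_thm4 (L : ℕ) (hL : 2 ≤ L) (hd : 1 ≤ d) {G : Subgroup 𝔸ˣ} (hG : AvgClosed d L G) (k : ℕ)
    (U₀ : Site d → Fin d → 𝔸ˣ) (hU : ∀ x κ, U₀ x κ ∈ G) {α₀ : ℝ} (hα : 0 < α₀)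
    (hα3 : C0 d * (α₀ * (L : ℝ) ^ 2) ≤ 1 / 3) (hα2 : 2 * (α₀ * (L : ℝ) ^ 2) ≤ c2' d L)
    (a : Site d) {M ρ : ℕ} (hρ : 1 ≤ ρ) (hρM : ρ ≤ M) (hM : 11 * (d : ℝ) < M)
    {η : ℝ} (hη : 0 < η) {Ω : ℕ → Set (Site d)} (hA : InAk L k η α₀ Ω U₀) (hT : tcube L a M ρ k ⊆ Ω (k - 1))
    (hsmall : 11 * (d : ℝ) ^ 2 * (L : ℝ) ^ 2 * α₀ + ((M : ℝ) + 4 * ρ) * d * (L : ℝ) ^ 2 * α₀ ≤ 1 / 6)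
    {c₁ : ℝ} {Restr : (Site d → 𝔸ˣ) → Prop} {Concl : ℝ → ℝ → (Site d → Fin d → 𝔸ˣ) → (Site d → 𝔸ˣ) → Prop}
    (hThm4 : Thm4AtOne L k η c₁ G a M ρ Restr Concl)
    (hc₁ : (L : ℝ) ^ 3 * α₀ + 6 * d * (L : ℝ) ^ 2 * M * α₀ ≤ c₁) :
    ∃ u : Site d → 𝔸ˣ, (∀ x, u x ∈ G) ∧ Restr u ∧
      Concl ((L : ℝ) ^ 3 * α₀) (6 * d * (L : ℝ) ^ 2 * M * α₀)
        (cutFixed L (tLo a ρ) (tHi a M ρ) U₀ k (ctr a M)) u ∧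
      (∀ u' : Site d → 𝔸ˣ, (∀ x, u' x ∈ G) → Restr u' →
        Concl ((L : ℝ) ^ 3 * α₀) (6 * d * (L : ℝ) ^ 2 * M * α₀)
          (cutFixed L (tLo a ρ) (tHi a M ρ) U₀ k (ctr a M)) u' → u' = u) ∧
      (∀ x, ((localGauge L (tLo a ρ) (tHi a M ρ) U₀ k (ctr a M))⁻¹ * u) x ∈ G) ∧
      AgreeOn (tlo L (tLo a ρ) k) (thi L (tHi a M ρ) k)
        (gaugeAct ((localGauge L (tLo a ρ) (tHi a M ρ) U₀ k (ctr a M))⁻¹ * u)⁻¹ U₀)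
        (gaugeAct u⁻¹ (cutFixed L (tLo a ρ) (tHi a M ρ) U₀ k (ctr a M))) := by
  have hL1 : 1 ≤ L := le_trans (by norm_num) hL
  have hM1 : 1 ≤ M := hρ.trans hρM
  have hLpos : (0 : ℝ) < L := by exact_mod_cast lt_of_lt_of_le (by norm_num) hL
  have hdpos : (0 : ℝ) < d := by exact_mod_cast hd
  have hMpos : (0 : ℝ) < M := by exact_mod_cast hM1
  have hα₀' : 0 < (L : ℝ) ^ 3 * α₀ := by positivity
  have hα₁' : 0 < 6 * (d : ℝ) * (L : ℝ) ^ 2 * M * α₀ := by positivity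
  obtain ⟨h132a, h132b, h133⟩ := ineq132_cubes L hL hd hG k U₀ hU hα hα3 hα2 a hρ hρM hM hη hA hT hsmall
  have hΩ : ∃ l, l ≤ k ∧ k ≤ l + 1 ∧ ∀ x, InBox (tlo L (tLo a ρ) k) (thi L (tHi a M ρ) k) x → x ∈ Ω l :=
    ⟨k - 1, Nat.sub_le _ _, by omega, fun x hx => hT hx⟩
  have hvG : ∀ x, localGauge L (tLo a ρ) (tHi a M ρ) U₀ k (ctr a M) x ∈ G :=
    localGauge_mem L hL hG k U₀ hU hα hα3 hα2 (tLo_le_tHi hM1) (pdevOn_lt_of_inAk hL1 hα hA hΩ) (ctr a M)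
  have hU''G : ∀ x κ, cutFixed L (tLo a ρ) (tHi a M ρ) U₀ k (ctr a M) x κ ∈ G :=
    cutCfg_mem (gaugeAct_mem_of hU hvG)
  have h166 : Cond166 L k a M ρ (1 : Site d → Fin d → 𝔸ˣ) (cutFixed L (tLo a ρ) (tHi a M ρ) U₀ k (ctr a M))
      (6 * d * (L : ℝ) ^ 2 * M * α₀) :=
    (cond166_one_iff L k a M ρ _ _).2 h133
  obtain ⟨u, ⟨huG, hR, hC⟩, huniq⟩ :=
    hThm4 hα₀' hα₁' hc₁ _ hU''G (one_inAk hL1 k hη hα₀' _) h132a h132b h166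
  exact ⟨u, huG, hR, hC, huniq, fun x => G.mul_mem (G.inv_mem (hvG x)) (huG x),
    agree135 _ _ U₀ _ u⟩

/-- **Proposition 6 from Theorem 4 with the PRINTED smallness "`7dL²Mα₀ ≤ c₁`"** (and the implicit `L ≤ dM`,
`smallness_134`). [cite: Balaban1985RegularSpaces, Prop. 6 p.99] -/
theorem prop6_of_thm4_printed (L : ℕ) (hL : 2 ≤ L) (hd : 1 ≤ d) {G : Subgroup 𝔸ˣ} (hG : AvgClosed d L G)
    (k : ℕ) (U₀ : Site d → Fin d → 𝔸ˣ) (hU : ∀ x κ, U₀ x κ ∈ G) {α₀ : ℝ} (hα : 0 < α₀)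
    (hα3 : C0 d * (α₀ * (L : ℝ) ^ 2) ≤ 1 / 3) (hα2 : 2 * (α₀ * (L : ℝ) ^ 2) ≤ c2' d L)
    (a : Site d) {M ρ : ℕ} (hρ : 1 ≤ ρ) (hρM : ρ ≤ M) (hM : 11 * (d : ℝ) < M) (hLdM : (L : ℝ) ≤ d * M)
    {η : ℝ} (hη : 0 < η) {Ω : ℕ → Set (Site d)} (hA : InAk L k η α₀ Ω U₀) (hT : tcube L a M ρ k ⊆ Ω (k - 1))
    (hsmall : 11 * (d : ℝ) ^ 2 * (L : ℝ) ^ 2 * α₀ + ((M : ℝ) + 4 * ρ) * d * (L : ℝ) ^ 2 * α₀ ≤ 1 / 6)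
    {c₁ : ℝ} {Restr : (Site d → 𝔸ˣ) → Prop} {Concl : ℝ → ℝ → (Site d → Fin d → 𝔸ˣ) → (Site d → 𝔸ˣ) → Prop}
    (hThm4 : Thm4AtOne L k η c₁ G a M ρ Restr Concl) (hc₁ : 7 * d * (L : ℝ) ^ 2 * M * α₀ ≤ c₁) :
    ∃ u : Site d → 𝔸ˣ, (∀ x, u x ∈ G) ∧ Restr u ∧
      Concl ((L : ℝ) ^ 3 * α₀) (6 * d * (L : ℝ) ^ 2 * M * α₀)
        (cutFixed L (tLo a ρ) (tHi a M ρ) U₀ k (ctr a M)) u ∧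
      (∀ u' : Site d → 𝔸ˣ, (∀ x, u' x ∈ G) → Restr u' →
        Concl ((L : ℝ) ^ 3 * α₀) (6 * d * (L : ℝ) ^ 2 * M * α₀)
          (cutFixed L (tLo a ρ) (tHi a M ρ) U₀ k (ctr a M)) u' → u' = u) ∧
      (∀ x, ((localGauge L (tLo a ρ) (tHi a M ρ) U₀ k (ctr a M))⁻¹ * u) x ∈ G) ∧
      AgreeOn (tlo L (tLo a ρ) k) (thi L (tHi a M ρ) k)
        (gaugeAct ((localGauge L (tLo a ρ) (tHi a M ρ) U₀ k (ctr a M))⁻¹ * u)⁻¹ U₀)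
        (gaugeAct u⁻¹ (cutFixed L (tLo a ρ) (tHi a M ρ) U₀ k (ctr a M))) :=
  prop6_of_thm4 L hL hd hG k U₀ hU hα hα3 hα2 a hρ hρM hM hη hA hT hsmall hThm4
    (smallness_134 (by exact_mod_cast lt_of_lt_of_le (by norm_num) hL) hα hLdM hc₁)

/-! ## §7. (1.137): `|(1/i) log Ū₀′ᵏ(x, x′)| ≤ |x − y|₁·4α₀ ≤ 2dMα₀` on `□^{(k)}`, for THIS `U₀′` -/

omit [NormOneClass 𝔸] [CompleteSpace 𝔸] in
/-- **(1.7) at the top level `j = k` on a box `⊂ Ω_k`**: `sup_{p ⊂ [lo, hi]} |U₀(∂p) − 1| < α₀L^{−2k}` (every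
plaquette with lower corner in `Ω_k` is "`p ∈ Ω_k`", p. 77). [cite: Balaban1985RegularSpaces, (1.7) p.77, p.98 ("□ ⊂ Ω_k")] -/
theorem pdevOn_lt_of_inAk_top {L : ℕ} (hL : 1 ≤ L) {k : ℕ} {η α : ℝ} (hα : 0 < α) {Ω : ℕ → Set (Site d)}
    {U : Site d → Fin d → 𝔸ˣ} (hA : InAk L k η α Ω U) {lo hi : Site d}
    (hΩ : ∀ x, InBox lo hi x → x ∈ Ω k) : pdevOn lo hi U < α * (((L : ℝ) ^ k)⁻¹) ^ 2 := by
  have hL0 : 0 < L := hL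
  refine pdevOn_lt_of_forall (by positivity) fun x μ ν hx _ => ?_
  rcases eq_or_ne μ ν with rfl | hμν
  · rw [hol_plaqWord_self, Units.val_one, sub_self, norm_zero]; positivity
  · exact (hA k le_rfl).1 x μ ν hμν (Or.inl (hΩ x hx))

/-- **(1.137), THE INEQUALITIES, AND `\overline{U₀″}ᵏ = Ū₀′ᵏ` ON `□^{(k)}`** (p. 99).  HYPOTHESES: `G` `AvgClosed`,
`L ≥ 2`, `U₀` `G`-valued in `𝔄_k({Ω_j}, α₀)` with `□̃ ⊂ Ω_{k−1}` (p. 98) and `□ ⊂ Ω_k` (p. 98), `M ≥ 1`, `α₀L²`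
Prop.-1/2-small, `dMα₀ ≤ 1/2`.  CONCLUSION, for `U₀′ = U₀^{v}` (`v = localGauge …`, the gauge of p. 98 with the
global axial gauge of `Ū₀′ᵏ` at the centre `y = ctr a M`), `U₀″ = cutFixed …`, and every bond
`⟨x, x + e_μ⟩ ⊂ □^{(k)} = [a, a + M − 1]^d`: `\overline{U₀″}ᵏ(x, x + e_μ) = Ū₀′ᵏ(x, x + e_μ)`,
`‖(1/i) log Ū₀′ᵏ(x, x + e_μ)‖ ≤ |x − y|₁·4α₀` and `|x − y|₁·4α₀ ≤ 2dMα₀`.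
[cite: Balaban1985RegularSpaces, Prop. 6 (1.137) p.99, (1.128)-(1.129) p.98; Balaban1985Averaging, Prop. 2 p.26] -/
theorem ineq137_cube (L : ℕ) (hL : 2 ≤ L) {G : Subgroup 𝔸ˣ} (hG : AvgClosed d L G) (k : ℕ)
    (U₀ : Site d → Fin d → 𝔸ˣ) (hU : ∀ x κ, U₀ x κ ∈ G) {α₀ : ℝ} (hα : 0 < α₀)
    (hα3 : C0 d * (α₀ * (L : ℝ) ^ 2) ≤ 1 / 3) (hα2 : 2 * (α₀ * (L : ℝ) ^ 2) ≤ c2' d L)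
    (a : Site d) {M : ℕ} (ρ : ℕ) (hM1 : 1 ≤ M) {η : ℝ} {Ω : ℕ → Set (Site d)} (hA : InAk L k η α₀ Ω U₀)
    (hT : tcube L a M ρ k ⊆ Ω (k - 1)) (hbox : box L a M k ⊆ Ω k) (hsmall : (d : ℝ) * M * α₀ ≤ 1 / 2)
    (x : Site d) (μ : Fin d) (hx : bLo L a 0 0 ≤ x) (hx' : x + e μ ≤ bHi L a M 0 0) :
    avgIter L (cutFixed L (tLo a ρ) (tHi a M ρ) U₀ k (ctr a M)) k x μ =
        avgIter L (gaugeAct (localGauge L (tLo a ρ) (tHi a M ρ) U₀ k (ctr a M)) U₀) k x μ ∧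
      ‖(Complex.I⁻¹ : ℂ) •
          mlog ((avgIter L (gaugeAct (localGauge L (tLo a ρ) (tHi a M ρ) U₀ k (ctr a M)) U₀) k x μ : 𝔸ˣ) :
            𝔸)‖ ≤ l1 (x - ctr a M) * (4 * α₀) ∧
      (l1 (x - ctr a M) : ℝ) * (4 * α₀) ≤ 2 * d * M * α₀ := by
  have hL1 : 1 ≤ L := le_trans (by norm_num) hL
  have hL0 : 0 < L := hL1
  have hLr : (1 : ℝ) ≤ L := by exact_mod_cast hL1
  have hUU : ∀ z κ, U₀ z κ ∈ U1 𝔸 := fun z κ => hG.le_U1 (hU z κ)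
  have hlohi : tLo a ρ ≤ tHi a M ρ := tLo_le_tHi hM1
  have hkk : ∀ i, tlo L (tLo a ρ) k i ≤ thi L (tHi a M ρ) k i := tlo_le_thi hL1 hlohi k
  -- the global carrier `Uc = π*(U₀|□̃)` and (1.7) on `□̃ ⊂ Ω_{k-1}`
  set Uc := clampCfg (tlo L (tLo a ρ) k) (thi L (tHi a M ρ) k) U₀ with hUc
  have hUcG : ∀ z κ, Uc z κ ∈ G := clampCfg_mem hU
  have hΩ : ∃ l, l ≤ k ∧ k ≤ l + 1 ∧ ∀ z, InBox (tlo L (tLo a ρ) k) (thi L (tHi a M ρ) k) z → z ∈ Ω l :=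
    ⟨k - 1, Nat.sub_le _ _, by omega, fun z hz => hT hz⟩
  have h17 : pdevOn (tlo L (tLo a ρ) k) (thi L (tHi a M ρ) k) U₀ <
      α₀ * (L : ℝ) ^ 2 * (((L : ℝ) ^ k)⁻¹) ^ 2 := pdevOn_lt_of_inAk hL1 hα hA hΩ
  have h17c : pdev Uc < α₀ * (L : ℝ) ^ 2 * (((L : ℝ) ^ k)⁻¹) ^ 2 := (pdev_clampCfg_le hkk hUU).trans_lt h17
  -- the gauge `v` of p. 98 on the global carrier: `G`-valued, global axial gauge of the top level at `y`
  obtain ⟨hvG, hUc'G, hpdev', -, -, hgax⟩ := gaugeFix_global L hL hG k Uc hUcG hα hα3 hα2 h17c (ctr a M)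
  set Uc' := gaugeAct (towerGauge L Uc k (ctr a M)) Uc with hUc'
  have hvU : ∀ z, localGauge L (tLo a ρ) (tHi a M ρ) U₀ k (ctr a M) z ∈ U1 𝔸 := fun z => hG.le_U1 (hvG z)
  have h17c' : pdev Uc' < α₀ * (L : ℝ) ^ 2 * (((L : ℝ) ^ k)⁻¹) ^ 2 := by rw [hpdev']; exact h17c
  -- `W = Ū_c′ᵏ` is `G`-valued everywhere (Proposition 2 of [3], `B8Ineq130.ineq128_global`)
  have hW : ∀ z κ, avgIter L Uc' k z κ ∈ U1 𝔸 := fun z κ =>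
    hG.le_U1 ((ineq128_global L hL hG k Uc' hUc'G hα hα3 hα2 h17c' 0 (Nat.zero_le _)).2 k
      (Nat.sub_zero k).ge z κ)
  -- `U₀′` and `U_c′` agree on the bonds of `□̃`, hence on those of `□ ⊂ □̃`
  have hagc : AgreeOn (tlo L (tLo a ρ) k) (thi L (tHi a M ρ) k) Uc'
      (gaugeAct (localGauge L (tLo a ρ) (tHi a M ρ) U₀ k (ctr a M)) U₀) :=
    gaugeAct_agree (clampCfg_agree U₀) _
  have hsubk : tlo L (tLo a ρ) k ≤ tlo L (bLo L a 0 0) k ∧ thi L (bHi L a M 0 0) k ≤ thi L (tHi a M ρ) k := by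
    rw [tlo_tLo, thi_tHi, tlo_bLo, thi_bHi, Nat.zero_add, Nat.mul_zero]
    exact le_of_margin_mono (Nat.zero_le _)
  have hsub0 : tLo a ρ ≤ bLo L a 0 0 ∧ bHi L a M 0 0 ≤ tHi a M ρ := by
    rw [tLo_eq L, tHi_eq L]
    exact le_of_margin_mono (Nat.zero_le _)
  -- (1.7) at level `k` on `□ ⊂ Ω_k`, moved to `U_c′`: `sup_{p ⊂ □} |U_c′(∂p) − 1| < α₀L^{−2k}`
  have hboxΩ : ∀ z, InBox (tlo L (bLo L a 0 0) k) (thi L (bHi L a M 0 0) k) z → z ∈ Ω k := by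
    intro z hz
    refine hbox ?_
    simpa [B8Eq131Cubes.box, Set.mem_setOf_eq, tlo_bLo, thi_bHi] using hz
  have h17top : pdevOn (tlo L (bLo L a 0 0) k) (thi L (bHi L a M 0 0) k) Uc' <
      α₀ * (((L : ℝ) ^ k)⁻¹) ^ 2 := by
    rw [pdevOn_congr (hagc.mono (fun i => hsubk.1 i) fun i => hsubk.2 i), pdevOn_gaugeAct hvU]
    exact pdevOn_lt_of_inAk_top hL1 hα hA hboxΩ
  -- Proposition 2 of [3] localised to the tower over `□^{(k)}` with `α₀/L²` for `α₀`: `|W(∂p′) − 1| < 2α₀`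
  have hLsq : (0 : ℝ) < (L : ℝ) ^ 2 := by positivity
  set α' : ℝ := α₀ / (L : ℝ) ^ 2 with hα'
  have hα'eq : α' * (L : ℝ) ^ 2 = α₀ := div_mul_cancel₀ α₀ hLsq.ne'
  have hα'pos : 0 < α' := div_pos hα hLsq
  have hαle : α₀ ≤ α₀ * (L : ℝ) ^ 2 := le_mul_of_one_le_right hα.le (one_le_pow₀ hLr)
  have hα3' : C0 d * (α' * (L : ℝ) ^ 2) ≤ 1 / 3 := by
    rw [hα'eq]; exact (mul_le_mul_of_nonneg_left hαle (C0_pos d).le).trans hα3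
  have hα2' : 2 * (α' * (L : ℝ) ^ 2) ≤ c2' d L := by rw [hα'eq]; linarith
  have h17' : pdevOn (tlo L (bLo L a 0 0) k) (thi L (bHi L a M 0 0) k) Uc' <
      α' * (L : ℝ) ^ 2 * (((L : ℝ) ^ k)⁻¹) ^ 2 := by rw [hα'eq]; exact h17top
  have hlohi0 : bLo L a 0 0 ≤ bHi L a M 0 0 := fun i => by
    have hM1' : (1 : ℤ) ≤ M := by exact_mod_cast hM1
    simp only [bLo, bHi, pow_zero, one_mul, Nat.cast_zero, sub_zero, add_zero]
    omega
  have h128 : B8Lemma1NonAbelian.PlaqSmall (avgIter L Uc' k) (bLo L a 0 0) (bHi L a M 0 0) (2 * α₀) := by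
    intro z κ μ' _ hz hz'
    have h := ineq128_local L hL hG k Uc' hUc'G hα'pos hα3' hα2' (bLo L a 0 0) (bHi L a M 0 0) hlohi0 h17' 0
      (Nat.zero_le _) z κ μ' hz hz'
    rw [Nat.sub_zero] at h
    refine h.le.trans (le_of_eq ?_)
    simp only [aLev, pow_zero, inv_one, one_pow, mul_one]
    rw [mul_assoc, hα'eq]
  -- geometry of `□^{(k)} = [a, a + M − 1]^d` about `y = ctr a M = a + ⌊(M − 1)/2⌋`, radius `⌊M/2⌋`
  have g1 : ((M - 1) / 2 : ℕ) ≤ M / 2 := Nat.div_le_div_right (Nat.sub_le _ _)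
  have g2 : M - 1 - (M - 1) / 2 ≤ M / 2 := by omega
  have g3 : ((M - 1) / 2 : ℕ) ≤ M - 1 := Nat.div_le_self _ _
  have hy0 : bLo L a 0 0 ≤ ctr a M := fun i => by
    simp only [bLo, ctr, pow_zero, one_mul, Nat.cast_zero, sub_zero]; omega
  have hy0' : ctr a M ≤ bHi L a M 0 0 := fun i => by
    simp only [bHi, ctr, pow_zero, one_mul, Nat.cast_zero, add_zero]; omega
  have hrad0 : ∀ i, ctr a M i - bLo L a 0 0 i ≤ (M / 2 : ℕ) ∧ bHi L a M 0 0 i - ctr a M i ≤ (M / 2 : ℕ) :=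
    fun i => by
      constructor <;> simp only [bLo, bHi, ctr, pow_zero, one_mul, Nat.cast_zero, sub_zero, add_zero] <;> omega
  have hside : 2 * ((M / 2 : ℕ) : ℝ) ≤ (M : ℝ) := by
    have : 2 * (M / 2) ≤ M := by omega
    exact_mod_cast this
  -- the axial gauge of `W` at `y` (everywhere, in particular on `□^{(k)}`), `u := 1`
  have hax : ∀ z, bLo L a 0 0 ≤ z → z ≤ bHi L a M 0 0 →
      hol (gaugeAct (1 : Site d → 𝔸ˣ) (avgIter L Uc' k)) (ctr a M) (treeWord (z - ctr a M)) = 1 :=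
    fun z _ _ => by rw [gaugeAct_one]; exact hgax z
  have h137 := ineq137_log_printed (avgIter L Uc' k) hW hy0 hy0' hrad0 hα.le h128 1 (U1 𝔸).one_mem hax hside
    hsmall x μ hx hx'
  rw [gaugeAct_one] at h137
  -- back to `U₀′` and `U₀″` on the bonds of `□^{(k)} ⊂ □̃^{(k)}` (locality of (43))
  have hxt : tlo L (tLo a ρ) 0 ≤ x := fun i => (hsub0.1 i).trans (hx i)
  have hxt' : x + e μ ≤ thi L (tHi a M ρ) 0 := fun i => (hx' i).trans (hsub0.2 i)
  have hag'' : AgreeOn (tlo L (tLo a ρ) k) (thi L (tHi a M ρ) k)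
      (cutFixed L (tLo a ρ) (tHi a M ρ) U₀ k (ctr a M)) Uc' :=
    fun z κ hz hz' => (cutCfg_agree _ _ _ z κ hz hz').trans (hagc.symm z κ hz hz')
  have e1 := avgIter_eq_of_agree hL1 hag'' (Nat.zero_le k) hxt hxt'
  have e2 := avgIter_eq_of_agree hL1 hagc.symm (Nat.zero_le k) hxt hxt'
  rw [Nat.sub_zero] at e1 e2
  refine ⟨e1.trans e2.symm, ?_, h137.2⟩
  rw [e2]
  exact h137.1

end Analytic

end Literature.MathematicalPhysics.QuantumFieldTheory.Balaban1983to89.B8Prop6OfThm4
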